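import Summits.QuantumFields.YangMills.Theorems.BalabanUVNodesN15PerCubeGreenSopRow
import Summits.QuantumFields.YangMills.Theorems.BalabanUVNodesN15PerCubeGreenSopCoarseGeometry
import Literature.MathematicalPhysics.QuantumFieldTheory.Balaban1983to89.B9Eq336RegularityClassesOrbit
import HarnessLib

/-!
# N15 = NE2, road (c) — PROGRAMME (PC), (PC-B): THE PER-CUBE GAUGED DATA OF `Q′G′²Q′ᵀ(U)` — for every cube `□` of the cover, in the cube's unitary gauge `u_□` (class (3.35) on the
# walk-locality box of `□`): the coarse gauge `𝕎_□`, the conjugated operator `𝕎_□S(U)𝕎_□ᵀ = S(U^{u_□})`, its row `≤ B(L^k)^{−(d+1)}e^{−δd}`, and its closeness to the flat `S(𝟙)`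
# `≤ (Σ + e^{−δd_Z(y)})·B(L^k)^{−(d+1)}e^{−δd}` with `d_Z ≥ w` on `supp h_□` (dag-n15-c g28, n15-c∕299d)

Cell `pub-ymgap`, seat `pub-ymgap-dag-n15-c` (generation g28; R134 (a), s1; HUMAN RULING D-0062).  `bears_on: R4∕N15 · K3⁸ SpineGivenEndpointR13SepCoPHV (stmt-QuantumFields-27366)`;
filed `--kind proof --supports stmt-QuantumFields-27366 --as helper` — COUNT-NEUTRAL.  0 `def`, 0 `sorry`.  Imports n15-c∕299a′ `…PerCubeGreenSopRow` (`hasMaj_cSop_of_reg335Box`; through it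
n15-c∕299a `hasMaj_cSop_sub_cSop_one_of_reg335_scaled`, n15-c∕198 `cSop_gauge`, n15-c∕264 `cvT_scGaugeU`, r06 `Reg335Cube`), n15-c∕299b `…PerCubeGreenSopCoarseGeometry` (`exists_farZone`,
`blockOf_up`), r06-orbit `reg335Cube_gaugeTr`.  Nothing in the tree is modified.

WHY ((PC-B), [B9] (3.95)–(3.96) p.411 with the local operators in the cubes' gauges, (3.34) p.396: «G(U^u) = R(u)G(U)R(u⁻¹)»).  dag-n15-w2's FILE 46 glues `(Q′G′²Q′ᵀ)⁻¹(U)` from local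
parametrices of the LOCAL operators `𝕎_kS(U)𝕎_kᵀ`; THIS FILE produces, cube by cube, everything about them the gluing consumes (n15-c∕299e): given per cube `k` a unitary gauge `u_k` and a
potential `A_k` with `U^{u_k} = e^{iηA_k}`, `|A_k| < Cξ⁻¹`, `|∇^ηA_k| < Cξ⁻²` on the walk-locality box `{x | B(x) ∈ c(Lw + 3w − 1 − m₀, k) + [0, Lw + 10w)}` (the class (3.35) asked there),
★★★ `exists_gaugedSop_rows` gives for every `k` a coarse gauge `𝕎` (orthogonal), the operator `A = 𝕎S(U)𝕎ᵀ` (`= S(U^{u_k})`, `cSop_gauge`), its row (n15-c∕299a′ at `U^{u_k}`, in the class on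
every two-collar box by `reg335Cube_gaugeTr`), its closeness to `S(𝟙)` weighted by `e^{−δd_Z(y)}` (n15-c∕299a at `U^{u_k}`, near cubes = those meeting the far zone's complement, whose
two-collar boxes sit in the walk-locality box by `exists_farZone`), and `d_Z ≥ w` on `supp h_k`.

HONEST FRAMING ∕ LIMITS.  MODEL carriers (n15-c∕262's cover of the doubled unit torus, `L ≥ 11`); the class is ASKED on the walk-locality boxes (side `(L+10)w` of the torus `2Lw`); no
operator of record estimated; [B9] cited for SHAPES ∕ MECHANISM.  NE2⁺ NOT PRINTED, NOT proved; N15 of record untouched; K3⁸ OPEN; counts UNMOVED.  Restate-immune (no Theses import).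
-/

noncomputable section

open scoped BigOperators Matrix Matrix.Norms.L2Operator

namespace Summit.QuantumFields.YangMills.BalabanUVNodes.N15.Gluing

open Real
open Literature.MathematicalPhysics.QuantumFieldTheory.Balaban1983to89
open Literature.MathematicalPhysics.QuantumFieldTheory.Balaban1983to89.B5Prop11Plancherel (Tor fine unitVec)
open Literature.MathematicalPhysics.QuantumFieldTheory.Balaban1983to89.B5Block118 (up bpt)
open Literature.MathematicalPhysics.QuantumFieldTheory.Balaban1983to89.B11SectG (BlockNorm HasMaj)
open Literature.MathematicalPhysics.QuantumFieldTheory.Balaban1983to89.B6UnitTorusCarrier (unitTorusGeo unitTorusGeo_dist_nonneg)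
open Literature.MathematicalPhysics.QuantumFieldTheory.Balaban1983to89.B9Eq335RegularityClasses (Reg335Cube)
open Literature.MathematicalPhysics.QuantumFieldTheory.Balaban1983to89.B9Eq336RegularityClassesOrbit (reg335Cube_gaugeTr)
open Literature.MathematicalPhysics.QuantumFieldTheory.Balaban1983to89.B9Eq3117Current (gaugeTr gaugeTr_apply gaugeTr_one)
open Literature.MathematicalPhysics.QuantumFieldTheory.Balaban1983to89.B9Eq39Adjoint (covD fluct)
open Summit.QuantumFields.YangMills.BalabanUVNodes.N15.CovLandau (cSop cSop_gauge bdiag bdiag_transpose)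
open Literature.MathematicalPhysics.QuantumFieldTheory.King1986 (aK aK_pos aK_le)
open Literature.MathematicalPhysics.QuantumFieldTheory.King1986.Torus (blockOf)
open Literature.Barriers.QuantumFields (traceForm)
open Summit.QuantumFields.YangMills.BalabanUVNodes.N15.MatrixSpecies (mmulOp coordMat basisConst liftBlk)
open Summit.QuantumFields.YangMills.BalabanUVNodes.N15.TwoGrid (cubeBlocks)
open Summit.QuantumFields.YangMills.BalabanUVNodes.N15.CurvedSpecies (uN_val_gaugeTr_eq uN_val_inv_eq_conjTranspose uN_coordMat_conj_orthogonal)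

variable {d : ℕ}

section Gauged

variable {L : ℕ} [NeZero L]

set_option maxHeartbeats 400000 in
/-- ★★★ **THE PER-CUBE GAUGED DATA OF `S(U) = Q′G′²Q′ᵀ(U)`.**  For a `U(m)` field `U` with, on the walk-locality box of EVERY cube `k`, a unitary gauge `u_k` and a potential `A_k`
(`U^{u_k} = e^{iηA_k}`, `|A_k| < Cξ⁻¹`, `|∇^ηA_k| < Cξ⁻²` there), and the (3.35) letters of size `r_V` small: for every cube `k` there are an orthogonal coarse gauge `𝕎` (`= coordMat e Ad_{u_k}`
at the block corners), the operator `A = M_𝕎 ∘ mulVecLin S(U) ∘ M_{𝕎ᵀ}` and a function `d_Z ≥ 0` with: `A ≤ B(L^k)^{−(d+1)}e^{−δd}`; `A − mulVecLin S(𝟙) ≤ (Σ(r_V) + e^{−δd_Z(y)})·B(L^k)^{−(d+1)}e^{−δd}`,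
`Σ(r_V) = r_V(1+|J⊕J|) + a_K|ι|(|ι|σ² + 2σ) + σ + (L^m)⁻¹`; and `d_Z(y) ≥ L^m` wherever `h_k(n·y) ≠ 0`.  MODEL carriers; the SHAPE of (3.95)'s local data in the gauges (3.34)–(3.35).
[cite: Balaban1985BackgroundPropagators, (3.34)–(3.35) p.396, (3.87) p.409, (3.95)–(3.96) p.411, Cor. 3.8 p.410 (shapes ∕ mechanism); Balaban1984PropagatorsI, (1.20) p.20] -/
theorem exists_gaugedSop_rows (hL : Odd L ∧ 1 < L) (hL11 : 11 ≤ L) {a₀ : ℝ} (ha₀ : 0 < a₀) (ι : Type) [Fintype ι] [DecidableEq ι] :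
    ∃ δ w₀ R₀ B : ℝ, 0 < δ ∧ 0 < R₀ ∧ 0 < B ∧
      ∀ (mv kk : ℕ), 1 ≤ kk → w₀ ≤ ((L ^ mv : ℕ) : ℝ) →
      ∀ {mm : Type} [Fintype mm] [DecidableEq mm] [Nonempty mm] (e : Matrix mm mm ℂ ≃L[ℝ] (ι → ℝ)), (∀ A B : Matrix mm mm ℂ, traceForm A B = e A ⬝ᵥ e B) →
      ∀ (U : Fin (d + 1) → ScX d L mv kk hL → (Matrix mm mm ℂ)ˣ), (∀ μ x, (U μ x : Matrix mm mm ℂ) ∈ Matrix.unitaryGroup mm ℂ) →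
      ∀ (ξ C : ℝ), 0 < ξ → 0 < C →
        (∀ k : Fin (d + 1) → ZMod (2 * L), ∃ (u : ScX d L mv kk hL → (Matrix mm mm ℂ)ˣ) (A : Fin (d + 1) → ScX d L mv kk hL → Matrix mm mm ℂ),
          (∀ x, (u x : Matrix mm mm ℂ) ∈ Matrix.unitaryGroup mm ℂ) ∧
          (∀ μ, ∀ z ∈ {x : ScX d L mv kk hL | blockOf (L ^ kk) (cvM d L mv kk hL) x ∈ cubeBlocks (cvM d L mv kk hL) (coverCorner (cvM d L mv kk hL) (L ^ mv) L (L * L ^ mv + 3 * L ^ mv - 1 - coverMargin L mv) k) (L * L ^ mv + 10 * L ^ mv)},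
              gaugeTr (scShift d L mv kk hL) u U μ z = fluct ((((L ^ kk : ℕ) : ℝ))⁻¹) A μ z) ∧
          (∀ μ, ∀ z ∈ {x : ScX d L mv kk hL | blockOf (L ^ kk) (cvM d L mv kk hL) x ∈ cubeBlocks (cvM d L mv kk hL) (coverCorner (cvM d L mv kk hL) (L ^ mv) L (L * L ^ mv + 3 * L ^ mv - 1 - coverMargin L mv) k) (L * L ^ mv + 10 * L ^ mv)},
              ‖A μ z‖ < C * ξ⁻¹) ∧
          (∀ μ ν, ∀ z ∈ {x : ScX d L mv kk hL | blockOf (L ^ kk) (cvM d L mv kk hL) x ∈ cubeBlocks (cvM d L mv kk hL) (coverCorner (cvM d L mv kk hL) (L ^ mv) L (L * L ^ mv + 3 * L ^ mv - 1 - coverMargin L mv) k) (L * L ^ mv + 10 * L ^ mv)},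
              ‖((↑((((L ^ kk : ℕ) : ℝ))⁻¹) : ℂ)⁻¹) • covD (scShift d L mv kk hL) (fun _ _ => (1 : (Matrix mm mm ℂ)ˣ)) μ (A ν) z‖ < C * (ξ ^ 2)⁻¹)) →
      ∀ (rV : ℝ), 0 ≤ rV →
        Fintype.card ι * (@basisConst ι _ (Matrix mm mm ℂ) Matrix.frobeniusNormedAddCommGroup Matrix.frobeniusNormedSpace e * (2 * Real.sqrt (Fintype.card mm)) * (Real.sqrt (Fintype.card mm) * ((C / ξ) * Real.exp (((((L ^ kk : ℕ) : ℝ))⁻¹) * (C / ξ))))) ≤ rV →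
        Fintype.card ι * (Fintype.card (Fin (d + 1)) * (Fintype.card ι * (@basisConst ι _ (Matrix mm mm ℂ) Matrix.frobeniusNormedAddCommGroup Matrix.frobeniusNormedSpace e * (2 * Real.sqrt (Fintype.card mm)) * (Real.sqrt (Fintype.card mm) * ((C / ξ) * Real.exp (((((L ^ kk : ℕ) : ℝ))⁻¹) * (C / ξ))))) ^ 2 + @basisConst ι _ (Matrix mm mm ℂ) Matrix.frobeniusNormedAddCommGroup Matrix.frobeniusNormedSpace e * (2 * Real.sqrt (Fintype.card mm)) * (Real.sqrt (Fintype.card mm) * ((C / ξ ^ 2) * Real.exp (((((L ^ kk : ℕ) : ℝ))⁻¹) * (C / ξ)))))) ≤ rV →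
        rV * (1 + Fintype.card (Fin (d + 1) ⊕ Fin (d + 1))) + a₀ * (Fintype.card ι * (Fintype.card ι * ((1 + rV * ((((L ^ kk : ℕ) : ℝ))⁻¹)) ^ ((d + 1) * L ^ kk) - 1) ^ 2 + 2 * ((1 + rV * ((((L ^ kk : ℕ) : ℝ))⁻¹)) ^ ((d + 1) * L ^ kk) - 1))) ≤ R₀ →
      ∀ k : Fin (d + 1) → ZMod (2 * L), ∃ (W : Tor (cvM d L mv kk hL) → Matrix ι ι ℝ) (A : (Tor (cvM d L mv kk hL) × ι → ℝ) →ₗ[ℝ] (Tor (cvM d L mv kk hL) × ι → ℝ)) (dZ : Tor (cvM d L mv kk hL) → ℝ),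
        (∀ y, (W y)ᵀ * W y = 1) ∧ (∀ y, W y * (W y)ᵀ = 1) ∧ (∀ y, 0 ≤ dZ y) ∧
        mmulOp W ∘ₗ Matrix.mulVecLin (cSop (cvM d L mv kk hL) (L ^ kk) (cvT e (fun μ x => (U μ x : Matrix mm mm ℂ))) (aK a₀ (L : ℝ) kk * (((L ^ kk : ℕ) : ℝ)) ^ (d + 1))) ∘ₗ mmulOp (fun y => (W y)ᵀ) = A ∧
        HasMaj (BlockNorm.ofBlocks (unitTorusGeo L kk (cvM d L mv kk hL)) (liftBlk (fun y : Tor (cvM d L mv kk hL) => y) ι)) (BlockNorm.ofBlocks (unitTorusGeo L kk (cvM d L mv kk hL)) (liftBlk (fun y : Tor (cvM d L mv kk hL) => y) ι))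
          A (fun y y' => B * ((((L ^ kk : ℕ) : ℝ)) ^ (d + 1))⁻¹ * Real.exp (-(δ * (unitTorusGeo L kk (cvM d L mv kk hL)).dist y y'))) ∧
        HasMaj (BlockNorm.ofBlocks (unitTorusGeo L kk (cvM d L mv kk hL)) (liftBlk (fun y : Tor (cvM d L mv kk hL) => y) ι)) (BlockNorm.ofBlocks (unitTorusGeo L kk (cvM d L mv kk hL)) (liftBlk (fun y : Tor (cvM d L mv kk hL) => y) ι))
          (A - Matrix.mulVecLin (cSop (cvM d L mv kk hL) (L ^ kk) (fun (_ : Fin (d + 1)) (_ : ScX d L mv kk hL) => (1 : Matrix ι ι ℝ)) (aK a₀ (L : ℝ) kk * (((L ^ kk : ℕ) : ℝ)) ^ (d + 1))))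
          (fun y y' => (rV * (1 + Fintype.card (Fin (d + 1) ⊕ Fin (d + 1))) + aK a₀ (L : ℝ) kk * (Fintype.card ι * (Fintype.card ι * ((1 + rV * ((((L ^ kk : ℕ) : ℝ))⁻¹)) ^ ((d + 1) * L ^ kk) - 1) ^ 2 + 2 * ((1 + rV * ((((L ^ kk : ℕ) : ℝ))⁻¹)) ^ ((d + 1) * L ^ kk) - 1))) +
              ((1 + rV * ((((L ^ kk : ℕ) : ℝ))⁻¹)) ^ ((d + 1) * L ^ kk) - 1) + (((L ^ mv : ℕ) : ℝ))⁻¹ + 1 * Real.exp (-(δ * dZ y))) *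
            (B * ((((L ^ kk : ℕ) : ℝ)) ^ (d + 1))⁻¹ * Real.exp (-(δ * (unitTorusGeo L kk (cvM d L mv kk hL)).dist y y')))) ∧
        (∀ y, scH d L mv kk hL k (up (L ^ kk) (cvM d L mv kk hL) y) ≠ 0 → ((L ^ mv : ℕ) : ℝ) ≤ dZ y) := by
  classical
  have hL7 : 7 ≤ L := by omega
  obtain ⟨δ₁, w₁, R₁, B₁, hδ₁, hR₁, hB₁, H₁⟩ := hasMaj_cSop_sub_cSop_one_of_reg335_scaled (d := d) hL hL7 ha₀ ι
  obtain ⟨δ₂, w₂, R₂, B₂, hδ₂, hR₂, hB₂, H₂⟩ := hasMaj_cSop_of_reg335Box (d := d) hL hL7 ha₀ ι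
  refine ⟨min δ₁ δ₂, max w₁ w₂, min R₁ R₂, max B₁ B₂, lt_min hδ₁ hδ₂, lt_min hR₁ hR₂, lt_max_of_lt_left hB₁, fun mv kk hk hw₀ => ?_⟩
  intro mm _ _ _ e he U hU ξ C hξ hC hbig rV hrV hrA hrC hRle k
  have hw₁ : w₁ ≤ ((L ^ mv : ℕ) : ℝ) := (le_max_left _ _).trans hw₀
  have hw₂ : w₂ ≤ ((L ^ mv : ℕ) : ℝ) := (le_max_right _ _).trans hw₀
  have hRle₁ := hRle.trans (min_le_left R₁ R₂)
  have hRle₂ := hRle.trans (min_le_right R₁ R₂)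
  have hM : ∀ ν, cvM d L mv kk hL ν = 2 * L * L ^ mv := MP_succ_eq L mv kk hL
  have hw : 0 < L ^ mv := pow_pos (by omega) _
  have hd : ∀ a b : Tor (cvM d L mv kk hL), 0 ≤ (unitTorusGeo L kk (cvM d L mv kk hL)).dist a b := unitTorusGeo_dist_nonneg L kk _
  have hnpos : (0 : ℝ) < ((L ^ kk : ℕ) : ℝ) ^ (d + 1) := by positivity
  -- the cube's gauge and the far zone
  obtain ⟨u, A, hu, hg, hA, hD⟩ := hbig k
  obtain ⟨Z, dZ, hdZ, hdZ0, hdZl, hmarg, hnear⟩ := exists_farZone (d := d) hL hL11 mv kk k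
  have hu' : ∀ x, ((u x : Matrix mm mm ℂ))ᴴ * (u x : Matrix mm mm ℂ) = 1 := fun x => Matrix.mem_unitaryGroup_iff'.mp (hu x)
  have hu1 : ∀ x, ‖(u x : Matrix mm mm ℂ)‖ ≤ 1 ∧ ‖(((u x)⁻¹ : (Matrix mm mm ℂ)ˣ) : Matrix mm mm ℂ)‖ ≤ 1 := fun x =>
    ⟨(CStarRing.norm_of_mem_unitary (hu x)).le, by
      rw [uN_val_inv_eq_conjTranspose (hu x)]
      exact (CStarRing.norm_of_mem_unitary (Unitary.star_mem (hu x))).le⟩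
  -- the gauged field `V = U^{u}`
  set V : Fin (d + 1) → ScX d L mv kk hL → (Matrix mm mm ℂ)ˣ := gaugeTr (scShift d L mv kk hL) u U with hVdef
  have hVu : ∀ μ x, (V μ x : Matrix mm mm ℂ) ∈ Matrix.unitaryGroup mm ℂ := fun μ x => by
    rw [hVdef, uN_val_gaugeTr_eq (T := scShift d L mv kk hL) U (hu (scShift d L mv kk hL μ x))]
    exact Submonoid.mul_mem _ (Submonoid.mul_mem _ (hu x) (hU μ x)) (Unitary.star_mem (hu (scShift d L mv kk hL μ x)))
  have hVval : (fun μ x => (V μ x : Matrix mm mm ℂ)) = scGaugeU d L mv kk hL (fun x => (u x : Matrix mm mm ℂ)) (fun μ x => (U μ x : Matrix mm mm ℂ)) := by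
    funext μ x
    rw [hVdef, uN_val_gaugeTr_eq (T := scShift d L mv kk hL) U (hu (scShift d L mv kk hL μ x))]
    rfl
  -- (3.35) for `U` and for `V` on every two-collar box
  have hboxU : ∀ k', Reg335Cube (scShift d L mv kk hL) U ((((L ^ kk : ℕ) : ℝ))⁻¹) {x : ScX d L mv kk hL | blockOf (L ^ kk) (cvM d L mv kk hL) x ∈ cubeBlocks (cvM d L mv kk hL) (coverCorner (cvM d L mv kk hL) (L ^ mv) L (2 * L ^ mv + 1) k') (6 * L ^ mv + 3)} ξ C := fun k' => by
    obtain ⟨u', A', hu'', hg', hA', hD'⟩ := hbig k'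
    have hsub : ∀ x : ScX d L mv kk hL, blockOf (L ^ kk) (cvM d L mv kk hL) x ∈ cubeBlocks (cvM d L mv kk hL) (coverCorner (cvM d L mv kk hL) (L ^ mv) L (2 * L ^ mv + 1) k') (6 * L ^ mv + 3) →
        blockOf (L ^ kk) (cvM d L mv kk hL) x ∈ cubeBlocks (cvM d L mv kk hL) (coverCorner (cvM d L mv kk hL) (L ^ mv) L (L * L ^ mv + 3 * L ^ mv - 1 - coverMargin L mv) k') (L * L ^ mv + 10 * L ^ mv) := fun x hx => by
      have hm₀ : coverMargin L mv ≤ L * L ^ mv := by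
        unfold coverMargin
        have : (L - 2) * L ^ mv ≤ L * L ^ mv := Nat.mul_le_mul_right _ (Nat.sub_le _ _)
        omega
      have h2m : 2 * coverMargin L mv ≤ (L - 2) * L ^ mv := by unfold coverMargin; omega
      have hLm : (L - 2) * L ^ mv = L * L ^ mv - 2 * L ^ mv := Nat.sub_mul L 2 (L ^ mv)
      have h10 : 10 * L ^ mv ≤ L * L ^ mv := Nat.mul_le_mul_right _ (by omega)
      have e2 : 2 * L * L ^ mv = 2 * (L * L ^ mv) := by ring
      exact mem_cubeBlocks_of_mem_inner hM (by omega) (by omega) (by omega) hx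
    have hu1' : ∀ x, ‖(u' x : Matrix mm mm ℂ)‖ ≤ 1 ∧ ‖(((u' x)⁻¹ : (Matrix mm mm ℂ)ˣ) : Matrix mm mm ℂ)‖ ≤ 1 := fun x =>
      ⟨(CStarRing.norm_of_mem_unitary (hu'' x)).le, by
        rw [uN_val_inv_eq_conjTranspose (hu'' x)]
        exact (CStarRing.norm_of_mem_unitary (Unitary.star_mem (hu'' x))).le⟩
    exact ⟨u', A', fun z _ => hu1' z, fun κ z hz => hg' κ z (hsub z hz), fun κ z hz => hA' κ z (hsub z hz), fun κ ν z hz => hD' κ ν z (hsub z hz)⟩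
  have hboxV : ∀ k', Reg335Cube (scShift d L mv kk hL) V ((((L ^ kk : ℕ) : ℝ))⁻¹) {x : ScX d L mv kk hL | blockOf (L ^ kk) (cvM d L mv kk hL) x ∈ cubeBlocks (cvM d L mv kk hL) (coverCorner (cvM d L mv kk hL) (L ^ mv) L (2 * L ^ mv + 1) k') (6 * L ^ mv + 3)} ξ C :=
    fun k' => reg335Cube_gaugeTr (scShift d L mv kk hL) (fun z _ => hu1 z) (hboxU k')
  -- near cubes: the cube's own datum serves on their two-collar boxes
  have hnearV : ∀ k', ¬ (cvSk d L mv kk hL k' ⊆ Z) → ∃ A' : Fin (d + 1) → ScX d L mv kk hL → Matrix mm mm ℂ,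
      (∀ μ, ∀ z ∈ {x : ScX d L mv kk hL | blockOf (L ^ kk) (cvM d L mv kk hL) x ∈ cubeBlocks (cvM d L mv kk hL) (coverCorner (cvM d L mv kk hL) (L ^ mv) L (2 * L ^ mv + 1) k') (6 * L ^ mv + 3)}, gaugeTr (scShift d L mv kk hL) (fun _ => (1 : (Matrix mm mm ℂ)ˣ)) V μ z = fluct ((((L ^ kk : ℕ) : ℝ))⁻¹) A' μ z) ∧
      (∀ μ, ∀ z ∈ {x : ScX d L mv kk hL | blockOf (L ^ kk) (cvM d L mv kk hL) x ∈ cubeBlocks (cvM d L mv kk hL) (coverCorner (cvM d L mv kk hL) (L ^ mv) L (2 * L ^ mv + 1) k') (6 * L ^ mv + 3)}, ‖A' μ z‖ < C * ξ⁻¹) ∧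
      (∀ μ ν, ∀ z ∈ {x : ScX d L mv kk hL | blockOf (L ^ kk) (cvM d L mv kk hL) x ∈ cubeBlocks (cvM d L mv kk hL) (coverCorner (cvM d L mv kk hL) (L ^ mv) L (2 * L ^ mv + 1) k') (6 * L ^ mv + 3)}, ‖((↑((((L ^ kk : ℕ) : ℝ))⁻¹) : ℂ)⁻¹) • covD (scShift d L mv kk hL) (fun _ _ => (1 : (Matrix mm mm ℂ)ˣ)) μ (A' ν) z‖ < C * (ξ ^ 2)⁻¹) := fun k' hk' =>
    ⟨A, fun μ z hz => by rw [gaugeTr_one]; exact hg μ z (hnear k' hk' hz), fun μ z hz => hA μ z (hnear k' hk' hz), fun μ ν z hz => hD μ ν z (hnear k' hk' hz)⟩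
  -- the coarse gauge
  set W : Tor (cvM d L mv kk hL) → Matrix ι ι ℝ := fun y => coordMat e (ContinuousLinearMap.mulLeftRight ℝ (Matrix mm mm ℂ) (u (bpt (L ^ kk) (cvM d L mv kk hL) y 0) : Matrix mm mm ℂ) ((u (bpt (L ^ kk) (cvM d L mv kk hL) y 0) : Matrix mm mm ℂ))ᴴ) with hWdef
  have hWo : ∀ y, (W y)ᵀ * W y = 1 ∧ W y * (W y)ᵀ = 1 := fun y => uN_coordMat_conj_orthogonal e he (hu' _)
  have hconj : mmulOp W ∘ₗ Matrix.mulVecLin (cSop (cvM d L mv kk hL) (L ^ kk) (cvT e (fun μ x => (U μ x : Matrix mm mm ℂ))) (aK a₀ (L : ℝ) kk * (((L ^ kk : ℕ) : ℝ)) ^ (d + 1))) ∘ₗ mmulOp (fun y => (W y)ᵀ) =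
      Matrix.mulVecLin (cSop (cvM d L mv kk hL) (L ^ kk) (cvT e (fun μ x => (V μ x : Matrix mm mm ℂ))) (aK a₀ (L : ℝ) kk * (((L ^ kk : ℕ) : ℝ)) ^ (d + 1))) := by
    have hW0 : ∀ x : ScX d L mv kk hL, (coordMat e (ContinuousLinearMap.mulLeftRight ℝ (Matrix mm mm ℂ) (u x : Matrix mm mm ℂ) ((u x : Matrix mm mm ℂ))ᴴ))ᵀ *
        coordMat e (ContinuousLinearMap.mulLeftRight ℝ (Matrix mm mm ℂ) (u x : Matrix mm mm ℂ) ((u x : Matrix mm mm ℂ))ᴴ) = 1 := fun x => (uN_coordMat_conj_orthogonal e he (hu' x)).1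
    rw [hVval, cvT_scGaugeU ι e he hu' (fun μ x => (U μ x : Matrix mm mm ℂ)), cSop_gauge (cvM d L mv kk hL) (L ^ kk) hW0, mmulOp_eq_mulVecLin_bdiag, mmulOp_eq_mulVecLin_bdiag,
      ← Matrix.mulVecLin_mul, ← Matrix.mulVecLin_mul, ← bdiag_transpose]
    rw [Matrix.mul_assoc]
  -- the two estimates at `V`
  have hrow := H₂ mv kk hk hw₂ e he V hVu ξ C hξ hC.le hboxV rV hrV hrA hrC hRle₂
  have hclose := H₁ mv kk hk hw₁ e he (fun k' => cvSk d L mv kk hL k' ⊆ Z) Z dZ hdZ hdZ0 hdZl (fun k' hk' => hk') V hVu ξ C hξ hC (fun k' _ => hboxV k') hnearV rV hrV hrA hrC hRle₁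
  refine ⟨W, _, dZ, fun y => (hWo y).1, fun y => (hWo y).2, hdZ0, hconj, ?_, ?_, fun y hy => ?_⟩
  · refine hrow.mono fun y y' => ?_
    have h1 : Real.exp (-(δ₂ * (unitTorusGeo L kk (cvM d L mv kk hL)).dist y y')) ≤ Real.exp (-(min δ₁ δ₂ * (unitTorusGeo L kk (cvM d L mv kk hL)).dist y y')) :=
      Real.exp_le_exp.2 (by nlinarith [hd y y', min_le_right δ₁ δ₂])
    calc B₂ * ((((L ^ kk : ℕ) : ℝ)) ^ (d + 1))⁻¹ * Real.exp (-(δ₂ * (unitTorusGeo L kk (cvM d L mv kk hL)).dist y y'))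
        ≤ B₂ * ((((L ^ kk : ℕ) : ℝ)) ^ (d + 1))⁻¹ * Real.exp (-(min δ₁ δ₂ * (unitTorusGeo L kk (cvM d L mv kk hL)).dist y y')) := mul_le_mul_of_nonneg_left h1 (by positivity)
      _ ≤ max B₁ B₂ * ((((L ^ kk : ℕ) : ℝ)) ^ (d + 1))⁻¹ * Real.exp (-(min δ₁ δ₂ * (unitTorusGeo L kk (cvM d L mv kk hL)).dist y y')) := by gcongr; exact le_max_right _ _
  · refine hclose.mono fun y y' => ?_
    have hη : (0 : ℝ) ≤ ((((L ^ kk : ℕ) : ℝ))⁻¹) := by positivity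
    have hSIG0 : 0 ≤ ((1 + rV * ((((L ^ kk : ℕ) : ℝ))⁻¹)) ^ ((d + 1) * L ^ kk) - 1) := by
      have := one_le_pow₀ (M₀ := ℝ) (a := 1 + rV * ((((L ^ kk : ℕ) : ℝ))⁻¹)) (le_add_of_nonneg_right (mul_nonneg hrV hη)) (n := (d + 1) * L ^ kk); linarith only [this]
    have haK := aK_pos ha₀ (by exact_mod_cast hL.2 : (1 : ℝ) < (L : ℝ)) hk
    have hS0 : 0 ≤ rV * (1 + Fintype.card (Fin (d + 1) ⊕ Fin (d + 1))) + aK a₀ (L : ℝ) kk * (Fintype.card ι * (Fintype.card ι * ((1 + rV * ((((L ^ kk : ℕ) : ℝ))⁻¹)) ^ ((d + 1) * L ^ kk) - 1) ^ 2 + 2 * ((1 + rV * ((((L ^ kk : ℕ) : ℝ))⁻¹)) ^ ((d + 1) * L ^ kk) - 1))) +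
        ((1 + rV * ((((L ^ kk : ℕ) : ℝ))⁻¹)) ^ ((d + 1) * L ^ kk) - 1) + (((L ^ mv : ℕ) : ℝ))⁻¹ :=
      add_nonneg (add_nonneg (add_nonneg (mul_nonneg hrV (by positivity)) (mul_nonneg haK.le (mul_nonneg (Nat.cast_nonneg _) (add_nonneg (by positivity) (mul_nonneg zero_le_two hSIG0))))) hSIG0) (by positivity)
    have h1 : Real.exp (-(δ₁ * (unitTorusGeo L kk (cvM d L mv kk hL)).dist y y')) ≤ Real.exp (-(min δ₁ δ₂ * (unitTorusGeo L kk (cvM d L mv kk hL)).dist y y')) :=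
      Real.exp_le_exp.2 (by nlinarith [hd y y', min_le_left δ₁ δ₂])
    have h2 : Real.exp (-(δ₁ * dZ y)) ≤ Real.exp (-(min δ₁ δ₂ * dZ y)) := Real.exp_le_exp.2 (by nlinarith [hdZ0 y, min_le_left δ₁ δ₂])
    have hB12 : B₁ ≤ max B₁ B₂ := le_max_left _ _
    have hE := Real.exp_nonneg (-(min δ₁ δ₂ * (unitTorusGeo L kk (cvM d L mv kk hL)).dist y y'))
    have hE' := Real.exp_nonneg (-(min δ₁ δ₂ * dZ y))
    calc B₁ * ((((L ^ kk : ℕ) : ℝ)) ^ (d + 1))⁻¹ * (rV * (1 + Fintype.card (Fin (d + 1) ⊕ Fin (d + 1))) + aK a₀ (L : ℝ) kk * (Fintype.card ι * (Fintype.card ι * ((1 + rV * ((((L ^ kk : ℕ) : ℝ))⁻¹)) ^ ((d + 1) * L ^ kk) - 1) ^ 2 + 2 * ((1 + rV * ((((L ^ kk : ℕ) : ℝ))⁻¹)) ^ ((d + 1) * L ^ kk) - 1))) +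
            ((1 + rV * ((((L ^ kk : ℕ) : ℝ))⁻¹)) ^ ((d + 1) * L ^ kk) - 1) + (((L ^ mv : ℕ) : ℝ))⁻¹ + Real.exp (-(δ₁ * dZ y))) * Real.exp (-(δ₁ * (unitTorusGeo L kk (cvM d L mv kk hL)).dist y y'))
        ≤ B₁ * ((((L ^ kk : ℕ) : ℝ)) ^ (d + 1))⁻¹ * (rV * (1 + Fintype.card (Fin (d + 1) ⊕ Fin (d + 1))) + aK a₀ (L : ℝ) kk * (Fintype.card ι * (Fintype.card ι * ((1 + rV * ((((L ^ kk : ℕ) : ℝ))⁻¹)) ^ ((d + 1) * L ^ kk) - 1) ^ 2 + 2 * ((1 + rV * ((((L ^ kk : ℕ) : ℝ))⁻¹)) ^ ((d + 1) * L ^ kk) - 1))) +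
            ((1 + rV * ((((L ^ kk : ℕ) : ℝ))⁻¹)) ^ ((d + 1) * L ^ kk) - 1) + (((L ^ mv : ℕ) : ℝ))⁻¹ + Real.exp (-(min δ₁ δ₂ * dZ y))) * Real.exp (-(min δ₁ δ₂ * (unitTorusGeo L kk (cvM d L mv kk hL)).dist y y')) := by
          gcongr
      _ ≤ _ := by
          rw [one_mul]
          nlinarith [mul_nonneg (mul_nonneg (sub_nonneg.2 hB12) (inv_nonneg.2 hnpos.le)) (mul_nonneg (add_nonneg hS0 hE') hE)]
  · rw [← blockOf_up (n := L ^ kk) y]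
    exact hmarg _ hy

end Gauged

end Summit.QuantumFields.YangMills.BalabanUVNodes.N15.Gluing

end
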